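import Summits.Schanuel.Schanuel.Theorems.SoloInformedX193Exceptional
import Summits.Schanuel.Schanuel.Theorems.SoloInformedX193Numerics

/-!
# X193 kernel line, file F4a: twist families (the toolkit of the NCD step, pen §3)

Solo seat `solo-Schanuel-informed`, X193 kernel programme (design note
`work/s213/X193-KERNEL-DESIGN.md`, Amendment A10; pen proof `work/s194/X193-pen.md` §3;
files F2 = `SoloInformedX193Service`, F6a = `SoloInformedX193Exceptional`,
F7d = `SoloInformedX193Numerics`; consumed by F4 = `SoloInformedX193NoCheapDepth`).

For a piece `P` of an abstract service structure `D : SoloServiceData ι` and columns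
`k, j ≥ 1`, the twist law (TW) = `twistLaw` provides the TWIST `Q_j = twist P k j`: same
degree, height `L_{Q_j} ≤ L_P + g_P log (max k j)`, bank `d_{Q_j}^j ≥ d_P^k - g_P log (max k j)`
at column `j`, composition `twist Q_j j j' = Q_{j'}` and `Q_j ≠ Q_{j'}` for `j ≠ j'`.  This
file unpacks (TW) and proves the three estimates the no-cheap-depth descent (file F4) is
assembled from:
* `exposure` — the entry law (L1) = `entryLaw` applied with a single active column `j` to a
  piece absent at a level `ℓ`: `min (d_Q^j, ℓ^ν) ≤ C_Q(ℓ) + A₂ (ℓ + g_Q + 1)² log (ℓ+2)`;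
* `twist_min_le` — transport of such a bound from the twist `Q_j` back to `P` at a level
  `n` where `P` is alive (so `g_P ≤ n` by the degree budget):
  `min (d_P^k, n^ν) ≤ C_P(n) + (2 + 9 A₂) n² log (n+2)`;
* `family_budget` — at a level `m` where all `⌊m^σ⌋₊` active twists are alive they are
  pairwise distinct pieces of cost `≥ C_{Q_j}(m) - m² log (m+2)` each, so the cost budget
  (Bud) gives `⌊m^σ⌋₊ (C_{Q_j}(m) - m² log (m+2)) ≤ 2 m^β m + b₁ m²`;
and the pure threshold `soloX_family_eventually`: for `σ + ν > 1 + β` the last display is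
eventually incompatible with a full bank `d ≥ (m-1)^ν` priced by (L1), i.e. eventually
`2 m^β m + b₁ m² < ⌊m^σ⌋₊ ((m-1)^ν - (1 + 4 A₂) m² log (m+2))`.
No sorries.
-/

namespace Summit.Schanuel.Schanuel.Theorems

open Finset Filter

/-! ### Pure inequalities -/

/-- `min` bookkeeping for a transported bank: `a ≤ b + c` with `c ≥ 0` gives
`min a R ≤ min b R + c`. -/
theorem soloX_min_le_min_add {a b c R : ℝ} (h : a ≤ b + c) (hc : 0 ≤ c) :
    min a R ≤ min b R + c := by
  rcases le_total b R with hb | hb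
  · rw [min_eq_left hb]
    exact (min_le_left a R).trans h
  · rw [min_eq_right hb]
    linarith [min_le_right a R]

/-- Two active columns `1 ≤ k` and `j` of a level `n ≥ 1` (`k, j ≤ n^σ`, `σ ≤ 1`) have
`0 ≤ log (max k j) ≤ log (n + 2)`. -/
theorem soloX_log_max_le {σ : ℝ} (hσ1 : σ ≤ 1) {n k j : ℕ} (hn : 1 ≤ n) (hk : 1 ≤ k)
    (hkσ : (k : ℝ) ≤ (n : ℝ) ^ σ) (hjσ : (j : ℝ) ≤ (n : ℝ) ^ σ) :
    0 ≤ Real.log ((max k j : ℕ) : ℝ) ∧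
      Real.log ((max k j : ℕ) : ℝ) ≤ Real.log ((n : ℝ) + 2) := by
  have hn1 : (1 : ℝ) ≤ n := by exact_mod_cast hn
  have hσn : (n : ℝ) ^ σ ≤ n := by
    calc (n : ℝ) ^ σ ≤ (n : ℝ) ^ (1 : ℝ) := Real.rpow_le_rpow_of_exponent_le hn1 hσ1
      _ = n := Real.rpow_one _
  have h1 : (1 : ℝ) ≤ ((max k j : ℕ) : ℝ) := by exact_mod_cast le_max_of_le_left hk
  have h2 : ((max k j : ℕ) : ℝ) ≤ (n : ℝ) + 2 := by
    rw [Nat.cast_max]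
    exact max_le (by linarith) (by linarith)
  exact ⟨Real.log_nonneg h1, Real.log_le_log (by linarith) h2⟩

/-- The budget violation of a full twist family (DESIGN A10 (iii)): for `0 < σ`, `2 < ν`,
`1 + β < σ + ν`, `1 ≤ β`, `b₁, A₂ ≥ 0`, eventually in the level `m`,
`2 m^β m + b₁ m² < ⌊m^σ⌋₊ ((m-1)^ν - (1 + 4 A₂) m² log (m+2))`. -/
theorem soloX_family_eventually {σ ν β b₁ A₂ : ℝ} (hσ : 0 < σ) (hν : 2 < ν)
    (hgap : 1 + β < σ + ν) (hβ : 1 ≤ β) (hb₁ : 0 ≤ b₁) (hA₂ : 0 ≤ A₂) :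
    ∀ᶠ m : ℕ in atTop,
      2 * ((m : ℝ) ^ β * m) + b₁ * (m : ℝ) ^ 2 <
        (⌊(m : ℝ) ^ σ⌋₊ : ℝ) *
          (((m : ℝ) - 1) ^ ν - (1 + 4 * A₂) * (m : ℝ) ^ 2 * Real.log ((m : ℝ) + 2)) := by
  have hB : (0 : ℝ) ≤ 1 + 4 * A₂ := by positivity
  have hlam : (0 : ℝ) < 2 / (2 : ℝ) ^ ν := by positivity
  filter_upwards [eventually_const_mul_rpow_le_rpow hσ 2, soloX_hbig_tail hB hlam hν,
    eventually_const_mul_rpow_le_rpow hgap ((2 + b₁) * (8 * (2 : ℝ) ^ ν)),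
    eventually_ge_atTop 2] with m h1 h2 h3 hm
  have hm2 : (2 : ℝ) ≤ m := by exact_mod_cast hm
  have hm0 : (0 : ℝ) < m := by linarith
  rw [Real.rpow_zero, mul_one] at h1
  -- the floor and the bracket
  have hfl : (m : ℝ) ^ σ / 2 ≤ (⌊(m : ℝ) ^ σ⌋₊ : ℝ) := by
    have := Nat.lt_floor_add_one ((m : ℝ) ^ σ)
    linarith
  have hpow : (m : ℝ) ^ ν / (2 : ℝ) ^ ν ≤ ((m : ℝ) - 1) ^ ν := by
    rw [← Real.div_rpow hm0.le (by norm_num : (0 : ℝ) ≤ 2)]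
    exact Real.rpow_le_rpow (by positivity) (by linarith) (by linarith)
  have htail : (1 + 4 * A₂) * (m : ℝ) ^ 2 * Real.log ((m : ℝ) + 2) ≤
      (m : ℝ) ^ ν / (2 : ℝ) ^ ν / 2 := by
    have e : 2 / (2 : ℝ) ^ ν / 4 * (m : ℝ) ^ ν = (m : ℝ) ^ ν / (2 : ℝ) ^ ν / 2 := by ring
    rw [← e]
    exact h2
  have hY : 0 < (m : ℝ) ^ ν / (2 : ℝ) ^ ν / 2 := by positivity
  have hR : (m : ℝ) ^ σ / 2 * ((m : ℝ) ^ ν / (2 : ℝ) ^ ν / 2) ≤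
      (⌊(m : ℝ) ^ σ⌋₊ : ℝ) *
        (((m : ℝ) - 1) ^ ν - (1 + 4 * A₂) * (m : ℝ) ^ 2 * Real.log ((m : ℝ) + 2)) :=
    mul_le_mul hfl (by linarith) hY.le (by positivity)
  -- the left side is at most `(2 + b₁) m^(1+β)`
  have hβ1 : (m : ℝ) ^ β * m = (m : ℝ) ^ (1 + β) := by
    rw [Real.rpow_add hm0, Real.rpow_one, mul_comm]
  have hsq : (m : ℝ) ^ 2 ≤ (m : ℝ) ^ β * m := by
    rw [pow_two]
    exact mul_le_mul_of_nonneg_right (Real.self_le_rpow_of_one_le (by linarith) hβ) hm0.le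
  have hL : 2 * ((m : ℝ) ^ β * m) + b₁ * (m : ℝ) ^ 2 ≤ (2 + b₁) * (m : ℝ) ^ (1 + β) := by
    rw [← hβ1]
    linarith [mul_le_mul_of_nonneg_left hsq hb₁]
  -- comparison of the powers
  rw [Real.rpow_add hm0 σ ν] at h3
  have hpos : 0 < (m : ℝ) ^ σ * (m : ℝ) ^ ν := by positivity
  have hkey : (2 + b₁) * (m : ℝ) ^ (1 + β) <
      (m : ℝ) ^ σ / 2 * ((m : ℝ) ^ ν / (2 : ℝ) ^ ν / 2) := by
    have e : (m : ℝ) ^ σ / 2 * ((m : ℝ) ^ ν / (2 : ℝ) ^ ν / 2) =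
        (m : ℝ) ^ σ * (m : ℝ) ^ ν / (4 * (2 : ℝ) ^ ν) := by ring
    rw [e, lt_div_iff₀ (by positivity)]
    linarith
  linarith

namespace SoloServiceData

variable {ι : Type*} (D : SoloServiceData ι)

/-! ### The twist laws, unpacked (columns `k, j, j' ≥ 1`) -/

/-- (TW) composition: `twist (twist P k j) j j' = twist P k j'`. -/
theorem twist_twist (hT : D ∈ twistLaw) (P : ι) {k j j' : ℕ} (hk : 1 ≤ k) (hj : 1 ≤ j)
    (hj' : 1 ≤ j') : D.twist (D.twist P k j) j j' = D.twist P k j' :=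
  (hT P k j j' hk hj hj').2.1

/-- (TW) distinct target columns give distinct twists. -/
theorem twist_ne (hT : D ∈ twistLaw) (P : ι) {k j j' : ℕ} (hk : 1 ≤ k) (hj : 1 ≤ j)
    (hj' : 1 ≤ j') (h : j ≠ j') : D.twist P k j ≠ D.twist P k j' :=
  (hT P k j j' hk hj hj').2.2.1 h

/-- (TW) twisting preserves the degree. -/
theorem deg_twist (hT : D ∈ twistLaw) (P : ι) {k j : ℕ} (hk : 1 ≤ k) (hj : 1 ≤ j) :
    D.deg (D.twist P k j) = D.deg P :=
  (hT P k j j hk hj hj).2.2.2.1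

/-- (TW) height of a twist: `L_{twist P k j} ≤ L_P + g_P log (max k j)`. -/
theorem logHt_twist_le (hT : D ∈ twistLaw) (P : ι) {k j : ℕ} (hk : 1 ≤ k) (hj : 1 ≤ j) :
    D.logHt (D.twist P k j) ≤ D.logHt P + D.deg P * Real.log ((max k j : ℕ) : ℝ) :=
  (hT P k j j hk hj hj).2.2.2.2.1

/-- (TW) bank of a twist at its own column: `d_P^k - g_P log (max k j) ≤ d_{twist P k j}^j`. -/
theorem bank_twist_ge (hT : D ∈ twistLaw) (P : ι) {k j : ℕ} (hk : 1 ≤ k) (hj : 1 ≤ j) :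
    D.bank P k - D.deg P * Real.log ((max k j : ℕ) : ℝ) ≤ D.bank (D.twist P k j) j :=
  (hT P k j j hk hj hj).2.2.2.2.2

/-! ### Exposure of an absent piece to the entry law -/

/-- (L1) with the single column `j`: a piece `Q` NOT alive at a level `ℓ ≥ n₀`, at an
active column `1 ≤ j ≤ ℓ^σ`, has `min (d_Q^j, ℓ^ν) ≤ C_Q(ℓ) + A₂ (ℓ + g_Q + 1)² log (ℓ+2)`. -/
theorem exposure {β σ ν A₂ : ℝ} {n₀ : ℕ} (hE : D ∈ entryLaw β σ ν A₂ n₀) {Q : ι}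
    {ℓ j : ℕ} (hℓ : n₀ ≤ ℓ) (hQ : Q ∉ D.alive ℓ) (hj : 1 ≤ j)
    (hjσ : (j : ℝ) ≤ (ℓ : ℝ) ^ σ) :
    min (D.bank Q j) ((ℓ : ℝ) ^ ν) ≤
      D.cost β Q ℓ + A₂ * ((ℓ : ℝ) + D.deg Q + 1) ^ 2 * Real.log ((ℓ : ℝ) + 2) := by
  have h := hE Q ℓ hℓ hQ {j} (fun k hk => by
    rw [Finset.mem_singleton] at hk
    rw [hk]
    exact ⟨hj, hjσ⟩)
  rw [Finset.sum_singleton, Finset.card_singleton, Nat.cast_one] at h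
  exact h

/-- The common tail of the exposures (DESIGN A10 (iii)): if the twist `Q_j = twist P k j`
of a piece `P` alive at `n ≥ n₀` (`1 ≤ k, j ≤ n^σ`) satisfies
`min (d_{Q_j}^j, n^ν) ≤ C_{Q_j}(n) + A₂ (n + g + 1)² log (n+2)`, then
`min (d_P^k, n^ν) ≤ C_P(n) + (2 + 9 A₂) n² log (n+2)`: transport the bank and the
height by (TW) (`g log (max k j) ≤ n log (n+2)`) and use `g ≤ n`. -/
theorem twist_min_le {c₀ β b₁ A₂ σ ν : ℝ} {n₀ : ℕ} (hW : D ∈ wellFormed c₀)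
    (hB : D ∈ budgetLaw β b₁ n₀) (hT : D ∈ twistLaw) (hσ1 : σ ≤ 1) (hA₂ : 0 ≤ A₂)
    {P : ι} {n k j : ℕ} (hn₀ : n₀ ≤ n) (hn : 1 ≤ n) (hP : P ∈ D.alive n) (hk : 1 ≤ k)
    (hkσ : (k : ℝ) ≤ (n : ℝ) ^ σ) (hj : 1 ≤ j) (hjσ : (j : ℝ) ≤ (n : ℝ) ^ σ)
    (hQ : min (D.bank (D.twist P k j) j) ((n : ℝ) ^ ν) ≤
      D.cost β (D.twist P k j) n +
        A₂ * ((n : ℝ) + D.deg (D.twist P k j) + 1) ^ 2 * Real.log ((n : ℝ) + 2)) :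
    min (D.bank P k) ((n : ℝ) ^ ν) ≤
      D.cost β P n + (2 + 9 * A₂) * (n : ℝ) ^ 2 * Real.log ((n : ℝ) + 2) := by
  obtain ⟨hl0, hl1⟩ := soloX_log_max_le hσ1 hn hk hkσ hjσ
  have hg : (D.deg P : ℝ) ≤ n := D.deg_le_level hW hB hn₀ hP
  have hg0 : (0 : ℝ) ≤ D.deg P := by positivity
  have hn1 : (1 : ℝ) ≤ n := by exact_mod_cast hn
  have hn0 : (0 : ℝ) ≤ n := by positivity
  have hlog : 0 ≤ Real.log ((n : ℝ) + 2) := Real.log_nonneg (by linarith)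
  have hdeg : (D.deg (D.twist P k j) : ℝ) = D.deg P := by
    exact_mod_cast D.deg_twist hT P hk hj
  -- height and cost of the twist
  have hL := D.logHt_twist_le hT P hk hj
  have hcost : D.cost β (D.twist P k j) n ≤
      D.cost β P n + (D.deg P : ℝ) * n * Real.log ((max k j : ℕ) : ℝ) := by
    unfold cost
    rw [hdeg]
    linarith [mul_le_mul_of_nonneg_right hL hn0]
  have hgl : (D.deg P : ℝ) * Real.log ((max k j : ℕ) : ℝ) ≤ n * Real.log ((n : ℝ) + 2) :=
    mul_le_mul hg hl1 hl0 hn0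
  have hnn : (n : ℝ) * Real.log ((n : ℝ) + 2) ≤ n * n * Real.log ((n : ℝ) + 2) := by
    have := mul_le_mul_of_nonneg_right hn1 (mul_nonneg hn0 hlog)
    linarith
  have hgnl : (D.deg P : ℝ) * n * Real.log ((max k j : ℕ) : ℝ) ≤
      (n : ℝ) ^ 2 * Real.log ((n : ℝ) + 2) := by
    rw [pow_two]
    linarith [mul_le_mul_of_nonneg_left hgl hn0]
  have hnl : (D.deg P : ℝ) * Real.log ((max k j : ℕ) : ℝ) ≤
      (n : ℝ) ^ 2 * Real.log ((n : ℝ) + 2) := by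
    rw [pow_two]
    linarith
  -- the error term
  have herr : A₂ * ((n : ℝ) + D.deg (D.twist P k j) + 1) ^ 2 * Real.log ((n : ℝ) + 2) ≤
      9 * A₂ * (n : ℝ) ^ 2 * Real.log ((n : ℝ) + 2) := by
    rw [hdeg]
    have h9 : ((n : ℝ) + D.deg P + 1) ^ 2 ≤ (3 * n) ^ 2 :=
      pow_le_pow_left₀ (by positivity) (by linarith) 2
    nlinarith [mul_le_mul_of_nonneg_right (mul_le_mul_of_nonneg_left h9 hA₂) hlog]
  -- transport of the bank
  have hbank := D.bank_twist_ge hT P hk hj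
  have hmin := soloX_min_le_min_add (R := (n : ℝ) ^ ν)
    (show D.bank P k ≤ D.bank (D.twist P k j) j + (D.deg P : ℝ) * Real.log ((max k j : ℕ) : ℝ)
      by linarith) (mul_nonneg hg0 hl0)
  linarith

/-! ### The budget of a full twist family at a good level -/

/-- At a level `m ≥ n₀` at which ALL active twists `Q_{j'} = twist P k j'`,
`1 ≤ j' ≤ m^σ`, are alive (a GOOD level), for any active `j`: the `⌊m^σ⌋₊` twists are
pairwise distinct, of multiplicity `≥ 1`, and of cost `≥ C_{Q_j}(m) - m² log (m+2)` each
(by (TW) composition their heights differ from `L_{Q_j}` by at most `g log m`), so the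
cost budget of the level gives `⌊m^σ⌋₊ (C_{Q_j}(m) - m² log (m+2)) ≤ 2 m^β m + b₁ m²`. -/
theorem family_budget {c₀ β b₁ σ : ℝ} {n₀ : ℕ} (hW : D ∈ wellFormed c₀)
    (hB : D ∈ budgetLaw β b₁ n₀) (hT : D ∈ twistLaw) (hσ1 : σ ≤ 1) {P : ι} {m k j : ℕ}
    (hm₀ : n₀ ≤ m) (hm : 1 ≤ m) (hk : 1 ≤ k) (hj : 1 ≤ j) (hjσ : (j : ℝ) ≤ (m : ℝ) ^ σ)
    (hgood : ∀ j' : ℕ, 1 ≤ j' → (j' : ℝ) ≤ (m : ℝ) ^ σ → D.twist P k j' ∈ D.alive m) :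
    (⌊(m : ℝ) ^ σ⌋₊ : ℝ) *
        (D.cost β (D.twist P k j) m - (m : ℝ) ^ 2 * Real.log ((m : ℝ) + 2)) ≤
      2 * ((m : ℝ) ^ β * m) + b₁ * (m : ℝ) ^ 2 := by
  classical
  set T : Finset ℕ := Finset.Icc 1 ⌊(m : ℝ) ^ σ⌋₊ with hTdef
  have hTmem : ∀ j' ∈ T, 1 ≤ j' ∧ (j' : ℝ) ≤ (m : ℝ) ^ σ := by
    intro j' hj'
    obtain ⟨h1, h2⟩ := Finset.mem_Icc.mp hj'
    exact ⟨h1, le_trans (by exact_mod_cast h2) (Nat.floor_le (by positivity))⟩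
  have hcard : (T.card : ℝ) = ⌊(m : ℝ) ^ σ⌋₊ := by simp [hTdef]
  have hm0 : (0 : ℝ) ≤ m := by positivity
  have hm1 : (1 : ℝ) ≤ m := by exact_mod_cast hm
  have hQa : D.twist P k j ∈ D.alive m := hgood j hj hjσ
  have hg : (D.deg P : ℝ) ≤ m := by
    have h := D.deg_le_level hW hB hm₀ hQa
    rwa [D.deg_twist hT P hk hj] at h
  -- per-twist lower bound
  have hlow : ∀ j' ∈ T, D.cost β (D.twist P k j) m - (m : ℝ) ^ 2 * Real.log ((m : ℝ) + 2) ≤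
      D.cost β (D.twist P k j') m := by
    intro j' hj'T
    obtain ⟨hj', hj'σ⟩ := hTmem j' hj'T
    obtain ⟨hl0, hl1⟩ := soloX_log_max_le hσ1 hm hj' hj'σ hjσ
    have hL := D.logHt_twist_le hT (D.twist P k j') hj' hj
    rw [D.twist_twist hT P hk hj' hj, D.deg_twist hT P hk hj'] at hL
    have hgl : (D.deg P : ℝ) * Real.log ((max j' j : ℕ) : ℝ) ≤ m * Real.log ((m : ℝ) + 2) :=
      mul_le_mul hg hl1 hl0 hm0
    unfold cost
    rw [D.deg_twist hT P hk hj, D.deg_twist hT P hk hj', pow_two]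
    linarith [mul_le_mul_of_nonneg_right hL hm0, mul_le_mul_of_nonneg_left hgl hm0]
  -- injectivity and the sum over the family
  have hinj : Set.InjOn (fun j' => D.twist P k j') (T : Set ℕ) := by
    intro i hi i' hi' h
    by_contra hne
    exact D.twist_ne hT P hk (hTmem i hi).1 (hTmem i' hi').1 hne h
  have hsum : (T.card : ℝ) *
        (D.cost β (D.twist P k j) m - (m : ℝ) ^ 2 * Real.log ((m : ℝ) + 2)) ≤
      ∑ j' ∈ T, D.cost β (D.twist P k j') m := by
    rw [← nsmul_eq_mul, ← Finset.sum_const]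
    exact Finset.sum_le_sum hlow
  have himg : ∑ j' ∈ T, D.cost β (D.twist P k j') m =
      ∑ Q ∈ T.image (fun j' => D.twist P k j'), D.cost β Q m :=
    (Finset.sum_image (f := fun Q => D.cost β Q m) hinj).symm
  have hsub : T.image (fun j' => D.twist P k j') ⊆ D.alive m := by
    intro Q hQ
    obtain ⟨j', hj', rfl⟩ := Finset.mem_image.mp hQ
    exact hgood j' (hTmem j' hj').1 (hTmem j' hj').2
  have hcost0 : ∀ Q, 0 ≤ D.cost β Q m := fun Q =>
    le_trans (by positivity) (D.rpow_le_cost hW β Q m)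
  have htot : ∑ Q ∈ T.image (fun j' => D.twist P k j'), D.cost β Q m ≤
      ∑ Q ∈ D.alive m, (D.mult Q m : ℝ) * D.cost β Q m := by
    refine (Finset.sum_le_sum_of_subset_of_nonneg hsub fun Q _ _ => hcost0 Q).trans ?_
    refine Finset.sum_le_sum fun Q hQ => ?_
    have hm1' : (1 : ℝ) ≤ D.mult Q m := D.one_le_mult_of_alive hW hQ
    nlinarith [hcost0 Q]
  have hbud := D.sum_mult_cost_le hB hm₀
  rw [hcard] at hsum
  linarith [hsum, himg, htot, hbud]

end SoloServiceData

end Summit.Schanuel.Schanuel.Theorems
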